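import Mathlib.Analysis.InnerProductSpace.Basic
import Mathlib.MeasureTheory.Integral.Bochner.Basic
import HarnessLib

/-!
# Band energy of time-limited functions, I: the abstract compression-plus-tail lemma

Cell `rh-explicit` (HOME `run/shared/lean/pub/rh-explicit/`), seat cc-s2-3 (`HOME/cc-s2-3/CERT-PLAN.md` §7,
sub-task E1 of lead ruling R4-10 (i)(a)).  First of four files proving the elementary, certificate-checked bound
`∫_{-1}^{1} |𝓕 f(ξ)|² dξ ≤ 0.9999428 · ‖f‖²` for every `f ∈ L²(ℝ)` vanishing off `[−1, 1]` (the top eigenvalue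
`λ₀ ≈ 0.99994275335` of the time–band limiting operator of Slepian–Landau–Pollak at `c = 2π`, i.e. of the pair of
projections defining Sonin's space `S(1,1)` of Connes–Consani 2021 §4, is NOT `1` — quantitatively), which every
Sonin-space certificate of the cell needs (distance of a band-clean vector to `S(1,1)`).

This file is pure inner-product-space algebra plus one integral estimate, no Fourier analysis and no numerics.
Given a finite pairwise-orthogonal family `p₀, …, p_{N−1}` of non-zero vectors of a complex inner product space `H`
(spanning `V`), a family of vectors `e_ξ ∈ H` indexed by a measure space, and a vector `f`, write
`f = P_V f + f_⊥` with the explicit projection `P_V f = Σ_j (⟪p_j, f⟫/‖p_j‖²) p_j` (written out in full).  Then pointwise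
`⟪e_ξ, f⟫ = Σ_j c_j ⟪e_ξ, p_j⟫ + ⟪e_ξ − P_V e_ξ, f_⊥⟫`, hence
`|⟪e_ξ, f⟫| ≤ |Σ_j c_j ⟪e_ξ, p_j⟫| + ‖e_ξ − P_V e_ξ‖ · ‖f_⊥‖`; if the compressed form is bounded by `a`
(`∫ |Σ_j c_j ⟪e_ξ, p_j⟫|² dξ ≤ a Σ_j |c_j|² ‖p_j‖²` for all coefficient vectors `c`) and the "tail trace"
`∫ ‖e_ξ − P_V e_ξ‖² dξ` is at most `τ`, then `∫ |⟪e_ξ, f⟫|² dξ ≤ (a + τ) ‖f‖²`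
(`integral_norm_sq_inner_le`; the weights `1 + τ/a`, `1 + a/τ` make the two pieces add up exactly).
In file IV this is applied with `H = L²[−1,1]`, `e_ξ = e^{2πixξ}`, `p_j` = Legendre polynomials of degree `≤ 14`,
so that `⟪e_ξ, f⟫ = 𝓕 f(ξ)`, `a` = a certified bound of the top generalized eigenvalue of the compressed form and
`τ = 4 − Σ_j M_jj/‖p_j‖²` (the trace of the sinc-kernel operator is `4`).  No facts, no axioms; Mathlib only.
-/

set_option linter.dupNamespace false  -- the mandated namespace repeats `RiemannHypothesis`

noncomputable section

open MeasureTheory Finset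
open scoped ComplexConjugate InnerProductSpace

namespace Summit.RiemannHypothesis.RiemannHypothesis.BandEnergy

variable {H : Type*} [NormedAddCommGroup H] [InnerProductSpace ℂ H]

/-! ## The explicit projection onto the span of a finite orthogonal family -/

section Proj

variable {N : ℕ} (p : Fin N → H)

variable {p}

/-! Throughout, the explicit projection of `f` onto `span {p_j}` is written out as
`∑ j, (⟪p j, f⟫_ℂ / (‖p j‖ : ℂ) ^ 2) • p j` (no auxiliary definitions, so that the file is proof-only). -/

omit [InnerProductSpace ℂ H] in
/-- `‖p_j‖² ≠ 0` in `ℂ` for a non-zero vector. [folklore] -/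
theorem normSq_cast_ne_zero (hp0 : ∀ j, p j ≠ 0) (j : Fin N) : ((‖p j‖ : ℂ) ^ 2) ≠ 0 :=
  pow_ne_zero 2 (by exact_mod_cast (norm_ne_zero_iff.mpr (hp0 j)))

/-- `⟪p_k, Σ_j c_j p_j⟫_ℂ = c_k ‖p_k‖²` for a pairwise orthogonal family. [folklore] -/
theorem inner_sum_smul_eq (horth : Pairwise fun j k => ⟪p j, p k⟫_ℂ = 0) (c : Fin N → ℂ) (k : Fin N) :
    ⟪p k, ∑ j, c j • p j⟫_ℂ = c k * ((‖p k‖ : ℂ) ^ 2) := by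
  rw [inner_sum]
  rw [Finset.sum_eq_single k]
  · rw [inner_smul_right, inner_self_eq_norm_sq_to_K]
    rfl
  · intro j _ hjk
    rw [inner_smul_right, horth (Ne.symm hjk), mul_zero]
  · intro hk; exact absurd (Finset.mem_univ k) hk

/-- `⟪Σ_j c_j p_j, y⟫_ℂ = Σ_j conj c_j ⟪p_j, y⟫_ℂ`. [folklore] -/
theorem sum_smul_inner (c : Fin N → ℂ) (y : H) :
    ⟪∑ j, c j • p j, y⟫_ℂ = ∑ j, conj (c j) * ⟪p j, y⟫_ℂ := by
  rw [sum_inner]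
  exact Finset.sum_congr rfl fun j _ => by rw [inner_smul_left]

/-- The residual `f − P_V f` is orthogonal to every `p_k`. [folklore] -/
theorem inner_sub_proj (hp0 : ∀ j, p j ≠ 0) (horth : Pairwise fun j k => ⟪p j, p k⟫_ℂ = 0) (f : H)
    (k : Fin N) : ⟪p k, f - (∑ j, (⟪p j, f⟫_ℂ / ((‖p j‖ : ℂ) ^ 2)) • p j)⟫_ℂ = 0 := by
  rw [inner_sub_right, inner_sum_smul_eq horth, div_mul_cancel₀ _ (normSq_cast_ne_zero hp0 k),
    sub_self]

/-- The residual is orthogonal to every vector of the span, in particular to any `Σ_j c_j p_j`. [folklore] -/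
theorem inner_sum_smul_sub_proj (hp0 : ∀ j, p j ≠ 0) (horth : Pairwise fun j k => ⟪p j, p k⟫_ℂ = 0)
    (c : Fin N → ℂ) (f : H) : ⟪∑ j, c j • p j, f - (∑ j, (⟪p j, f⟫_ℂ / ((‖p j‖ : ℂ) ^ 2)) • p j)⟫_ℂ = 0 := by
  rw [sum_smul_inner]
  exact Finset.sum_eq_zero fun j _ => by rw [inner_sub_proj hp0 horth f j, mul_zero]

/-- `‖Σ_j c_j p_j‖² = Σ_j |c_j|² ‖p_j‖²` (Pythagoras for a pairwise orthogonal family). [folklore] -/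
theorem norm_sum_smul_sq (horth : Pairwise fun j k => ⟪p j, p k⟫_ℂ = 0) (c : Fin N → ℂ) :
    ‖∑ j, c j • p j‖ ^ 2 = ∑ j, ‖c j‖ ^ 2 * ‖p j‖ ^ 2 := by
  have h : ⟪∑ j, c j • p j, ∑ j, c j • p j⟫_ℂ = ∑ j, (((‖c j‖ ^ 2 * ‖p j‖ ^ 2 : ℝ)) : ℂ) := by
    rw [sum_smul_inner]
    refine Finset.sum_congr rfl fun j _ => ?_
    rw [inner_sum_smul_eq horth c j, ← mul_assoc, Complex.conj_mul' (c j)]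
    push_cast
    ring
  have h2 : (‖∑ j, c j • p j‖ ^ 2 : ℝ) = (⟪∑ j, c j • p j, ∑ j, c j • p j⟫_ℂ).re := by
    rw [← inner_self_eq_norm_sq (𝕜 := ℂ)]; rfl
  rw [h2, h, ← Complex.ofReal_sum, Complex.ofReal_re]

/-- `‖P_V f‖² = Σ_j |⟪p_j, f⟫_ℂ|² / ‖p_j‖²`. [folklore] -/
theorem norm_proj_sq (hp0 : ∀ j, p j ≠ 0) (horth : Pairwise fun j k => ⟪p j, p k⟫_ℂ = 0) (f : H) :
    ‖(∑ j, (⟪p j, f⟫_ℂ / ((‖p j‖ : ℂ) ^ 2)) • p j)‖ ^ 2 = ∑ j, ‖⟪p j, f⟫_ℂ‖ ^ 2 / ‖p j‖ ^ 2 := by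
  rw [norm_sum_smul_sq horth]
  refine Finset.sum_congr rfl fun j _ => ?_
  have hj : (‖p j‖ : ℝ) ≠ 0 := norm_ne_zero_iff.mpr (hp0 j)
  rw [norm_div, norm_pow, Complex.norm_real, Real.norm_eq_abs, abs_norm]
  field_simp

/-- `‖f‖² = ‖P_V f‖² + ‖f − P_V f‖²`. [folklore] -/
theorem norm_sq_eq_proj_add (hp0 : ∀ j, p j ≠ 0) (horth : Pairwise fun j k => ⟪p j, p k⟫_ℂ = 0) (f : H) :
    ‖f‖ ^ 2 = ‖(∑ j, (⟪p j, f⟫_ℂ / ((‖p j‖ : ℂ) ^ 2)) • p j)‖ ^ 2 + ‖f - (∑ j, (⟪p j, f⟫_ℂ / ((‖p j‖ : ℂ) ^ 2)) • p j)‖ ^ 2 := by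
  have h0 : ⟪(∑ j, (⟪p j, f⟫_ℂ / ((‖p j‖ : ℂ) ^ 2)) • p j), f - (∑ j, (⟪p j, f⟫_ℂ / ((‖p j‖ : ℂ) ^ 2)) • p j)⟫_ℂ = 0 := inner_sum_smul_sub_proj hp0 horth _ f
  have h := norm_add_sq_eq_norm_sq_add_norm_sq_of_inner_eq_zero ((∑ j, (⟪p j, f⟫_ℂ / ((‖p j‖ : ℂ) ^ 2)) • p j)) (f - (∑ j, (⟪p j, f⟫_ℂ / ((‖p j‖ : ℂ) ^ 2)) • p j)) h0
  rw [add_sub_cancel] at h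
  simpa only [sq] using h

/-- The pointwise splitting `⟪e, f⟫_ℂ = Σ_j c_j ⟪e, p_j⟫_ℂ + ⟪e − P_V e, f − P_V f⟫_ℂ`, `c_j = ⟪p_j, f⟫_ℂ/‖p_j‖²`. [folklore] -/
theorem inner_eq_sum_add_inner_sub_proj (hp0 : ∀ j, p j ≠ 0) (horth : Pairwise fun j k => ⟪p j, p k⟫_ℂ = 0)
    (e f : H) :
    ⟪e, f⟫_ℂ = ∑ j, (⟪p j, f⟫_ℂ / ((‖p j‖ : ℂ) ^ 2)) * ⟪e, p j⟫_ℂ + ⟪e - (∑ j, (⟪p j, e⟫_ℂ / ((‖p j‖ : ℂ) ^ 2)) • p j), f - (∑ j, (⟪p j, f⟫_ℂ / ((‖p j‖ : ℂ) ^ 2)) • p j)⟫_ℂ := by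
  have h1 : ⟪e, (∑ j, (⟪p j, f⟫_ℂ / ((‖p j‖ : ℂ) ^ 2)) • p j)⟫_ℂ = ∑ j, (⟪p j, f⟫_ℂ / ((‖p j‖ : ℂ) ^ 2)) * ⟪e, p j⟫_ℂ := by
    rw [inner_sum]
    exact Finset.sum_congr rfl fun j _ => by rw [inner_smul_right]
  have h2 : ⟪(∑ j, (⟪p j, e⟫_ℂ / ((‖p j‖ : ℂ) ^ 2)) • p j), f - (∑ j, (⟪p j, f⟫_ℂ / ((‖p j‖ : ℂ) ^ 2)) • p j)⟫_ℂ = 0 := inner_sum_smul_sub_proj hp0 horth _ f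
  calc ⟪e, f⟫_ℂ = ⟪e, (∑ j, (⟪p j, f⟫_ℂ / ((‖p j‖ : ℂ) ^ 2)) • p j)⟫_ℂ + ⟪e, f - (∑ j, (⟪p j, f⟫_ℂ / ((‖p j‖ : ℂ) ^ 2)) • p j)⟫_ℂ := by rw [← inner_add_right, add_sub_cancel]
    _ = ⟪e, (∑ j, (⟪p j, f⟫_ℂ / ((‖p j‖ : ℂ) ^ 2)) • p j)⟫_ℂ + (⟪e - (∑ j, (⟪p j, e⟫_ℂ / ((‖p j‖ : ℂ) ^ 2)) • p j), f - (∑ j, (⟪p j, f⟫_ℂ / ((‖p j‖ : ℂ) ^ 2)) • p j)⟫_ℂ + ⟪(∑ j, (⟪p j, e⟫_ℂ / ((‖p j‖ : ℂ) ^ 2)) • p j), f - (∑ j, (⟪p j, f⟫_ℂ / ((‖p j‖ : ℂ) ^ 2)) • p j)⟫_ℂ) := by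
        rw [← inner_add_left, sub_add_cancel]
    _ = _ := by rw [h1, h2, add_zero]

/-- The pointwise estimate `|⟪e, f⟫_ℂ| ≤ |Σ_j c_j ⟪e, p_j⟫_ℂ| + ‖e − P_V e‖ · ‖f − P_V f‖`. [folklore] -/
theorem norm_inner_le_compressed_add_tail (hp0 : ∀ j, p j ≠ 0)
    (horth : Pairwise fun j k => ⟪p j, p k⟫_ℂ = 0) (e f : H) :
    ‖⟪e, f⟫_ℂ‖ ≤ ‖∑ j, (⟪p j, f⟫_ℂ / ((‖p j‖ : ℂ) ^ 2)) * ⟪e, p j⟫_ℂ‖ + ‖e - (∑ j, (⟪p j, e⟫_ℂ / ((‖p j‖ : ℂ) ^ 2)) • p j)‖ * ‖f - (∑ j, (⟪p j, f⟫_ℂ / ((‖p j‖ : ℂ) ^ 2)) • p j)‖ := by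
  rw [inner_eq_sum_add_inner_sub_proj hp0 horth e f]
  exact (norm_add_le _ _).trans (by gcongr; exact norm_inner_le_norm _ _)

end Proj

/-! ## The weighted Young step and the main estimate -/

/-- `(A + B)² ≤ (1 + θ) A² + (1 + θ⁻¹) B²` for `θ > 0`. [folklore] -/
theorem add_sq_le_weighted {A B θ : ℝ} (hθ : 0 < θ) :
    (A + B) ^ 2 ≤ (1 + θ) * A ^ 2 + (1 + θ⁻¹) * B ^ 2 := by
  have h : (1 + θ) * A ^ 2 + (1 + θ⁻¹) * B ^ 2 - (A + B) ^ 2 = (θ * A - B) ^ 2 / θ := by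
    field_simp
    ring
  have h2 : 0 ≤ (θ * A - B) ^ 2 / θ := div_nonneg (sq_nonneg _) hθ.le
  linarith

variable {X : Type*} [MeasurableSpace X] {μ : Measure X} {N : ℕ}

/-- **The compression-plus-tail bound.**  Let `p₀, …, p_{N−1}` be pairwise orthogonal non-zero vectors of a
complex inner product space `H`, `e : X → H` a family of vectors over a measure space and `f ∈ H`.  Suppose
(i) the compressed form is bounded by `a > 0`: `∫ |Σ_j c_j ⟪e_ξ, p_j⟫_ℂ|² dμ ≤ a · Σ_j |c_j|² ‖p_j‖²` for every
`c`, and (ii) the tail trace is at most `τ > 0`: `∫ ‖e_ξ − P_V e_ξ‖² dμ ≤ τ`.  Then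
`∫ |⟪e_ξ, f⟫_ℂ|² dμ ≤ (a + τ) ‖f‖²`.  (Pointwise `|⟪e_ξ,f⟫_ℂ| ≤ |Σ c_j⟪e_ξ,p_j⟫_ℂ| + ‖e_ξ − P_V e_ξ‖‖f − P_V f‖`,
then the weighted Young inequality with `θ = τ/a` and `‖f‖² = ‖P_V f‖² + ‖f − P_V f‖²`.) [folklore] -/
theorem integral_norm_sq_inner_le (p : Fin N → H) (hp0 : ∀ j, p j ≠ 0)
    (horth : Pairwise fun j k => ⟪p j, p k⟫_ℂ = 0) (e : X → H) {a τ : ℝ} (ha : 0 < a) (hτ : 0 < τ)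
    (hformInt : ∀ c : Fin N → ℂ, Integrable (fun ξ => ‖∑ j, c j * ⟪e ξ, p j⟫_ℂ‖ ^ 2) μ)
    (hform : ∀ c : Fin N → ℂ, ∫ ξ, ‖∑ j, c j * ⟪e ξ, p j⟫_ℂ‖ ^ 2 ∂μ ≤ a * ∑ j, ‖c j‖ ^ 2 * ‖p j‖ ^ 2)
    (htailInt : Integrable (fun ξ => ‖e ξ - (∑ j, (⟪p j, e ξ⟫_ℂ / ((‖p j‖ : ℂ) ^ 2)) • p j)‖ ^ 2) μ)
    (htail : ∫ ξ, ‖e ξ - (∑ j, (⟪p j, e ξ⟫_ℂ / ((‖p j‖ : ℂ) ^ 2)) • p j)‖ ^ 2 ∂μ ≤ τ)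
    (f : H) (hf : Integrable (fun ξ => ‖⟪e ξ, f⟫_ℂ‖ ^ 2) μ) :
    ∫ ξ, ‖⟪e ξ, f⟫_ℂ‖ ^ 2 ∂μ ≤ (a + τ) * ‖f‖ ^ 2 := by
  set c : Fin N → ℂ := fun j => ⟪p j, f⟫_ℂ / ((‖p j‖ : ℂ) ^ 2) with hc
  set w : H := f - (∑ j, (⟪p j, f⟫_ℂ / ((‖p j‖ : ℂ) ^ 2)) • p j) with hw
  set θ : ℝ := τ / a with hθdef
  have hθ : 0 < θ := div_pos hτ ha
  -- pointwise bound
  have hpt : ∀ ξ, ‖⟪e ξ, f⟫_ℂ‖ ^ 2 ≤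
      (1 + θ) * ‖∑ j, c j * ⟪e ξ, p j⟫_ℂ‖ ^ 2 + (1 + θ⁻¹) * (‖w‖ ^ 2 * ‖e ξ - (∑ j, (⟪p j, e ξ⟫_ℂ / ((‖p j‖ : ℂ) ^ 2)) • p j)‖ ^ 2) := by
    intro ξ
    have h1 := norm_inner_le_compressed_add_tail hp0 horth (e ξ) f
    have hA : 0 ≤ ‖∑ j, (⟪p j, f⟫_ℂ / ((‖p j‖ : ℂ) ^ 2)) * ⟪e ξ, p j⟫_ℂ‖ := norm_nonneg _
    have hB : 0 ≤ ‖e ξ - (∑ j, (⟪p j, e ξ⟫_ℂ / ((‖p j‖ : ℂ) ^ 2)) • p j)‖ * ‖f - (∑ j, (⟪p j, f⟫_ℂ / ((‖p j‖ : ℂ) ^ 2)) • p j)‖ := mul_nonneg (norm_nonneg _) (norm_nonneg _)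
    calc ‖⟪e ξ, f⟫_ℂ‖ ^ 2 ≤ (‖∑ j, (⟪p j, f⟫_ℂ / ((‖p j‖ : ℂ) ^ 2)) * ⟪e ξ, p j⟫_ℂ‖ + ‖e ξ - (∑ j, (⟪p j, e ξ⟫_ℂ / ((‖p j‖ : ℂ) ^ 2)) • p j)‖ * ‖f - (∑ j, (⟪p j, f⟫_ℂ / ((‖p j‖ : ℂ) ^ 2)) • p j)‖) ^ 2 := by
          gcongr
      _ ≤ (1 + θ) * ‖∑ j, (⟪p j, f⟫_ℂ / ((‖p j‖ : ℂ) ^ 2)) * ⟪e ξ, p j⟫_ℂ‖ ^ 2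
            + (1 + θ⁻¹) * (‖e ξ - (∑ j, (⟪p j, e ξ⟫_ℂ / ((‖p j‖ : ℂ) ^ 2)) • p j)‖ * ‖f - (∑ j, (⟪p j, f⟫_ℂ / ((‖p j‖ : ℂ) ^ 2)) • p j)‖) ^ 2 := add_sq_le_weighted hθ
      _ = _ := by rw [hc, hw]; ring
  -- integrate
  have hint : ∫ ξ, ‖⟪e ξ, f⟫_ℂ‖ ^ 2 ∂μ ≤
      (1 + θ) * ∫ ξ, ‖∑ j, c j * ⟪e ξ, p j⟫_ℂ‖ ^ 2 ∂μ
        + (1 + θ⁻¹) * (‖w‖ ^ 2 * ∫ ξ, ‖e ξ - (∑ j, (⟪p j, e ξ⟫_ℂ / ((‖p j‖ : ℂ) ^ 2)) • p j)‖ ^ 2 ∂μ) := by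
    have hR : Integrable (fun ξ => (1 + θ) * ‖∑ j, c j * ⟪e ξ, p j⟫_ℂ‖ ^ 2
        + (1 + θ⁻¹) * (‖w‖ ^ 2 * ‖e ξ - (∑ j, (⟪p j, e ξ⟫_ℂ / ((‖p j‖ : ℂ) ^ 2)) • p j)‖ ^ 2)) μ :=
      ((hformInt c).const_mul _).add ((htailInt.const_mul _).const_mul _)
    calc ∫ ξ, ‖⟪e ξ, f⟫_ℂ‖ ^ 2 ∂μ
        ≤ ∫ ξ, ((1 + θ) * ‖∑ j, c j * ⟪e ξ, p j⟫_ℂ‖ ^ 2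
            + (1 + θ⁻¹) * (‖w‖ ^ 2 * ‖e ξ - (∑ j, (⟪p j, e ξ⟫_ℂ / ((‖p j‖ : ℂ) ^ 2)) • p j)‖ ^ 2)) ∂μ := integral_mono hf hR hpt
      _ = _ := by
          rw [integral_add ((hformInt c).const_mul _) ((htailInt.const_mul _).const_mul _),
            integral_const_mul, integral_const_mul, integral_const_mul]
  -- the two hypotheses
  have hv : ∑ j, ‖c j‖ ^ 2 * ‖p j‖ ^ 2 = ‖(∑ j, (⟪p j, f⟫_ℂ / ((‖p j‖ : ℂ) ^ 2)) • p j)‖ ^ 2 := by rw [norm_sum_smul_sq horth]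
  have h1 : (1 + θ) * ∫ ξ, ‖∑ j, c j * ⟪e ξ, p j⟫_ℂ‖ ^ 2 ∂μ ≤ (1 + θ) * (a * ‖(∑ j, (⟪p j, f⟫_ℂ / ((‖p j‖ : ℂ) ^ 2)) • p j)‖ ^ 2) := by
    have := hform c; rw [hv] at this
    exact mul_le_mul_of_nonneg_left this (by positivity)
  have h2 : (1 + θ⁻¹) * (‖w‖ ^ 2 * ∫ ξ, ‖e ξ - (∑ j, (⟪p j, e ξ⟫_ℂ / ((‖p j‖ : ℂ) ^ 2)) • p j)‖ ^ 2 ∂μ) ≤ (1 + θ⁻¹) * (‖w‖ ^ 2 * τ) := by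
    have : ‖w‖ ^ 2 * ∫ ξ, ‖e ξ - (∑ j, (⟪p j, e ξ⟫_ℂ / ((‖p j‖ : ℂ) ^ 2)) • p j)‖ ^ 2 ∂μ ≤ ‖w‖ ^ 2 * τ :=
      mul_le_mul_of_nonneg_left htail (sq_nonneg _)
    exact mul_le_mul_of_nonneg_left this (by positivity)
  have hsplit : ‖f‖ ^ 2 = ‖(∑ j, (⟪p j, f⟫_ℂ / ((‖p j‖ : ℂ) ^ 2)) • p j)‖ ^ 2 + ‖w‖ ^ 2 := norm_sq_eq_proj_add hp0 horth f
  have hkey : (1 + θ) * (a * ‖(∑ j, (⟪p j, f⟫_ℂ / ((‖p j‖ : ℂ) ^ 2)) • p j)‖ ^ 2) + (1 + θ⁻¹) * (‖w‖ ^ 2 * τ) = (a + τ) * ‖f‖ ^ 2 := by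
    rw [hsplit, hθdef]
    field_simp
    ring
  linarith [hint, h1, h2, hkey.le]

end Summit.RiemannHypothesis.RiemannHypothesis.BandEnergy
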